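import Summits.QuantumFields.YangMills.Theorems.UnitScaleTiltProp7ConjFrameTransport
import HarnessLib

/-!
# Route `UnitScaleTilt`, crux K1 «MinimiserStabilityRegPr» (stmt-QuantumFields-19200), route-R E′ path (α′), LEMMA-H-curved, file F-H3a′ (companion of
# ✓ `UnitScaleTiltProp7ConjFrameTransport`) — TWO FRAMES: the transition function between two frame-transports, its exact recursion along the lattice, and the
# frame-mismatch row of the corner blend

Cell `ym3-torus`, extra width seat `ym-routeR-w4` (g9).  Design of record (x2′-corner) for F-H3 (★routeR-w1 g5, 2026-08-28 18:49Z): ONE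
[Balaban1985BackgroundPropagators] (3.35) cube gauge `u_ε` around each centre `c_ε` (`Reg335Cube`: `W^{u_ε} = e^{iηA_ε}`, `|A_ε| < Cξ⁻¹`, `|∇A_ε| < Cξ⁻²`), frames
`P_ε := u_ε⁻¹·u_ε(c_ε)`, corner blend `Φ = Σ_ε w_ε·R(P_ε)m_ε`.  Where two cubes overlap the main term compares `R(P_ε x)m` with `R(P_{ε′} x)m′` through the TRANSITION
FUNCTION `g(x) := (P x)⁻¹·P′(x)`.  THEOREMS ONLY (0 `def`, 0 `sorry`), abstract carrier of ✓`Prop7CovariantCurlOfGrad` ∕ ✓`Prop7ConjFrameTransport` (sites `S`, directions `ι`,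
shifts `T : ι → Equiv.Perm S`, background `U : ι → S → 𝔸ˣ`, letters `R` of `B9Eq39Adjoint`, inline frame holonomy `h_μ(x) := (P x)⁻¹·U μ x·P (T μ x)`);
`--supports stmt-QuantumFields-19200`, count-neutral.  YM₃ on T³ is a ladder rung (R3), not the Clay problem; nothing here claims LEMMA-H-curved, a stub, the crux or the gap.

WHAT IS PROVED (ns `…Theorems.Prop7ConjFrameTransition`).
* §1 (any ring) ★ `transition_step` — `g(x + e_μ) = h_μ(x)⁻¹·g(x)·h′_μ(x)` EXACTLY (both frames see the same background bond, which cancels); `transition_step_symm` (the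
  bond arriving at `x`); `R_frame_transition` (`R(P x)(R(g x)m) = R(P′ x)m`); `R_eq_self_of_central`.
* §2 (normed ring `𝔸 : Type`, bi-contractive frames and background = ✓`B9Thm310CommutatorDataOfPlaquettes.bicontr_mul∕bicontr_inv` letters) `norm_inv_mul_mul_sub_le`
  (`‖a⁻¹gb − g‖ ≤ ‖a − 1‖ + ‖b − 1‖`); ★ `norm_transition_step_sub_le` — `‖g(x + e_μ) − g(x)‖ ≤ ‖h_μ(x) − 1‖ + ‖h′_μ(x) − 1‖`; ★ `norm_transition_foldl_sub_le` — along
  any chain of `n` forward∕backward shifts (an explicit `List (Equiv.Perm S)`, no path letter of any carrier), under uniform holonomy defects `τ, τ′`: `‖g(x_n) − g(x_0)‖ ≤ n(τ + τ′)`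
  (at the consumer: `≤ 2dℓ` steps inside the overlap of two corner cubes, `τ, τ′ ≍ eℓ⁻¹` ⇒ `O(e)` — DESIGN-FH3 v2 count (i)); ★ `norm_frame_mismatch_le` —
  `‖R(P x)(R(g x)m′) − R(P x)(R(g x₀)m′)‖ ≤ 2‖g(x) − g(x₀)‖·‖m′ − c‖` for central `c` (only `m̊′` is charged).
HONEST SCOPE.  Exact group∕ring algebra and triangle inequalities ([folklore]; letters of [Balaban1985BackgroundPropagators] (3.1)–(3.4), (3.35)); the (3.35) instantiation
(`h = fluct η A`, `P = u⁻¹`) and the blend are F-H3α∕β's (★routeR-w1 g5).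

References: T. Bałaban, CMP 99 (1985) 389–434 [Balaban1985BackgroundPropagators] ((3.1)–(3.4) pp.390–391, (3.35) p.396); CMP 102 (1985) 277–309 [Balaban1985Variational]
(Sect. A p.280, Prop. 7 p.299).
-/

noncomputable section

namespace Summit.QuantumFields.YangMills.Theorems.Prop7ConjFrameTransition

open Literature.MathematicalPhysics.QuantumFieldTheory.Balaban1983to89
open B9Eq39Adjoint (R R_def R_add R_sub R_one R_inv_R covD covDstar divB)
open B9Eq310Hermitian (norm_R_le)
open B9Thm310CommutatorDataOfPlaquettes (bicontr_mul bicontr_inv)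

/-! ## §1–§2 Two frames: the transition function and the frame-mismatch row

Design of record (x2′-corner) for F-H3 (★routeR-w1 g5, 2026-08-28): ONE [Balaban1985BackgroundPropagators] (3.35) cube gauge `u_ε` around each centre,
frames `P_ε := u_ε⁻¹·u_ε(c_ε)`, corner blend `Φ = Σ_ε w_ε·R(P_ε)m_ε`.  Where two cubes overlap the main term compares `R(P_ε)m` with `R(P_{ε′})m′` through the
TRANSITION FUNCTION `g(x) := (P x)⁻¹·P′(x)`: `R(P′ x)m′ = R(P x)(R(g x)m′)` and, since both frames see the SAME background bond, `g(x + e_μ) = h_μ(x)⁻¹·g(x)·h′_μ(x)` —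
so `g` moves by at most `‖h_μ(x) − 1‖ + ‖h′_μ(x) − 1‖` per bond (`≲ 2A₀ ≍ eℓ⁻¹` for (3.35) frames), by `n(τ + τ′)` along any `n`-step lattice chain, and the mismatch
`R(P x)(R(g x)m′) − R(P x)(R(g x₀)m′)` costs `2‖g(x) − g(x₀)‖·‖m̊′‖`.  Exact algebra + triangle inequalities; the chain is an explicit `List` of shift permutations
(forward `T μ` or backward `(T μ).symm`), so no path letter of any carrier is needed. -/

section TwoFrames

variable {𝔸 : Type*} [Ring 𝔸] {S : Type*} {ι : Type*} (T : ι → Equiv.Perm S) (U : ι → S → 𝔸ˣ)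

/-- **TRANSITION RECURSION, EXACT**: `(P(x+e_μ))⁻¹P′(x+e_μ) = h_μ(x)⁻¹·((P x)⁻¹P′ x)·h′_μ(x)` — the background bond cancels between the two frame holonomies. [folklore] -/
theorem transition_step (P P' : S → 𝔸ˣ) (μ : ι) (x : S) :
    (P (T μ x))⁻¹ * P' (T μ x)
      = ((P x)⁻¹ * U μ x * P (T μ x))⁻¹ * ((P x)⁻¹ * P' x) * ((P' x)⁻¹ * U μ x * P' (T μ x)) := by
  group

/-- The same recursion read backwards: `(P y)⁻¹P′ y = h_μ(y)·((P x)⁻¹P′ x)·h′_μ(y)⁻¹` for `y = x − e_μ` (`h_μ(y)`, `h′_μ(y)` the holonomies of the bond ARRIVING at `x`). [folklore] -/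
theorem transition_step_symm (P P' : S → 𝔸ˣ) (μ : ι) (x : S) :
    (P ((T μ).symm x))⁻¹ * P' ((T μ).symm x)
      = ((P ((T μ).symm x))⁻¹ * U μ ((T μ).symm x) * P x) * ((P x)⁻¹ * P' x)
          * ((P' ((T μ).symm x))⁻¹ * U μ ((T μ).symm x) * P' x)⁻¹ := by
  group

omit T U in
/-- **FRAME CHANGE**: `R(P x)(R((P x)⁻¹P′ x) m) = R(P′ x) m`. [folklore] -/
theorem R_frame_transition (P P' : S → 𝔸ˣ) (m : 𝔸) (x : S) :
    R (P x) (R ((P x)⁻¹ * P' x) m) = R (P' x) m := by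
  rw [← B9Eq39Adjoint.R_mul, mul_inv_cancel_left]

omit T U in
/-- A central element is fixed by every conjugation. [folklore] -/
theorem R_eq_self_of_central (W : 𝔸ˣ) (c : 𝔸) (hc : ∀ a : 𝔸, Commute c a) : R W c = c := by
  rw [R_def, ← (hc (W : 𝔸)).eq, mul_assoc, Units.mul_inv, mul_one]

end TwoFrames

section TwoFramesNorm

variable {𝔸 : Type} [NormedRing 𝔸] {S : Type*} {ι : Type*} (T : ι → Equiv.Perm S) (U : ι → S → 𝔸ˣ)

omit T U in
/-- `‖a⁻¹·g·b − g‖ ≤ ‖a − 1‖ + ‖b − 1‖` for bi-contractive `a, g` and any unit `b` (`a⁻¹gb − g = a⁻¹g(b − 1) + a⁻¹(1 − a)g`). [folklore] -/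
theorem norm_inv_mul_mul_sub_le {a g : 𝔸ˣ} (b : 𝔸ˣ) (ha : ‖(a : 𝔸)‖ ≤ 1 ∧ ‖((a⁻¹ : 𝔸ˣ) : 𝔸)‖ ≤ 1)
    (hg : ‖(g : 𝔸)‖ ≤ 1 ∧ ‖((g⁻¹ : 𝔸ˣ) : 𝔸)‖ ≤ 1) :
    ‖((a⁻¹ * g * b : 𝔸ˣ) : 𝔸) - g‖ ≤ ‖(a : 𝔸) - 1‖ + ‖(b : 𝔸) - 1‖ := by
  have e : ((a⁻¹ * g * b : 𝔸ˣ) : 𝔸) - g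
      = ((a⁻¹ : 𝔸ˣ) : 𝔸) * (g : 𝔸) * ((b : 𝔸) - 1) + (((a⁻¹ : 𝔸ˣ) : 𝔸) * (1 - (a : 𝔸))) * (g : 𝔸) := by
    simp only [Units.val_mul, mul_sub, sub_mul, mul_one, one_mul, Units.inv_mul]
    abel
  rw [e]
  have h1 : ‖((a⁻¹ : 𝔸ˣ) : 𝔸) * (g : 𝔸) * ((b : 𝔸) - 1)‖ ≤ ‖(b : 𝔸) - 1‖ := by
    calc _ ≤ ‖((a⁻¹ : 𝔸ˣ) : 𝔸) * (g : 𝔸)‖ * ‖(b : 𝔸) - 1‖ := norm_mul_le _ _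
      _ ≤ 1 * ‖(b : 𝔸) - 1‖ := by
          gcongr
          exact (norm_mul_le _ _).trans (by nlinarith [ha.2, hg.1, norm_nonneg ((a⁻¹ : 𝔸ˣ) : 𝔸), norm_nonneg (g : 𝔸)])
      _ = ‖(b : 𝔸) - 1‖ := one_mul _
  have h2 : ‖(((a⁻¹ : 𝔸ˣ) : 𝔸) * (1 - (a : 𝔸))) * (g : 𝔸)‖ ≤ ‖(a : 𝔸) - 1‖ := by
    calc _ ≤ ‖((a⁻¹ : 𝔸ˣ) : 𝔸) * (1 - (a : 𝔸))‖ * ‖(g : 𝔸)‖ := norm_mul_le _ _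
      _ ≤ (‖((a⁻¹ : 𝔸ˣ) : 𝔸)‖ * ‖1 - (a : 𝔸)‖) * 1 := by gcongr; exacts [norm_mul_le _ _, hg.1]
      _ ≤ (1 * ‖1 - (a : 𝔸)‖) * 1 := by gcongr; exact ha.2
      _ = ‖(a : 𝔸) - 1‖ := by rw [one_mul, mul_one, norm_sub_rev]
  exact (norm_add_le _ _).trans (by linarith)

/-- ★ **THE TRANSITION FUNCTION MOVES BY THE TWO HOLONOMY DEFECTS**: with `g := (P ·)⁻¹P′`, `‖g(x + e_μ) − g(x)‖ ≤ ‖h_μ(x) − 1‖ + ‖h′_μ(x) − 1‖` at bi-contractive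
frames and background. [cite: Balaban1985BackgroundPropagators, (3.35) p.396] -/
theorem norm_transition_step_sub_le {P P' : S → 𝔸ˣ} (hP : ∀ z : S, ‖(P z : 𝔸)‖ ≤ 1 ∧ ‖(((P z)⁻¹ : 𝔸ˣ) : 𝔸)‖ ≤ 1)
    (hP' : ∀ z : S, ‖(P' z : 𝔸)‖ ≤ 1 ∧ ‖(((P' z)⁻¹ : 𝔸ˣ) : 𝔸)‖ ≤ 1)
    (hU : ∀ (κ : ι) (z : S), ‖(U κ z : 𝔸)‖ ≤ 1 ∧ ‖(((U κ z)⁻¹ : 𝔸ˣ) : 𝔸)‖ ≤ 1) (μ : ι) (x : S) :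
    ‖(((P (T μ x))⁻¹ * P' (T μ x) : 𝔸ˣ) : 𝔸) - (((P x)⁻¹ * P' x : 𝔸ˣ) : 𝔸)‖
      ≤ ‖(((P x)⁻¹ * U μ x * P (T μ x) : 𝔸ˣ) : 𝔸) - 1‖ + ‖(((P' x)⁻¹ * U μ x * P' (T μ x) : 𝔸ˣ) : 𝔸) - 1‖ := by
  rw [transition_step T U P P' μ x]
  exact norm_inv_mul_mul_sub_le _
    (bicontr_mul (bicontr_mul (bicontr_inv (hP x)) (hU μ x)) (hP (T μ x)))
    (bicontr_mul (bicontr_inv (hP x)) (hP' x))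

/-- ★ **ALONG A LATTICE CHAIN** of `n` steps (each a forward shift `T μ` or a backward shift `(T μ).symm`), under uniform holonomy defects `τ, τ′` of the two frames:
`‖g(x_n) − g(x_0)‖ ≤ n·(τ + τ′)` (at the consumer: a chain of `≤ 2dℓ` steps inside the overlap of two corner cubes, `τ, τ′ ≍ eℓ⁻¹` ⇒ `O(e)`). [cite: Balaban1985BackgroundPropagators, (3.35) p.396] -/
theorem norm_transition_foldl_sub_le {P P' : S → 𝔸ˣ} (hP : ∀ z : S, ‖(P z : 𝔸)‖ ≤ 1 ∧ ‖(((P z)⁻¹ : 𝔸ˣ) : 𝔸)‖ ≤ 1)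
    (hP' : ∀ z : S, ‖(P' z : 𝔸)‖ ≤ 1 ∧ ‖(((P' z)⁻¹ : 𝔸ˣ) : 𝔸)‖ ≤ 1)
    (hU : ∀ (κ : ι) (z : S), ‖(U κ z : 𝔸)‖ ≤ 1 ∧ ‖(((U κ z)⁻¹ : 𝔸ˣ) : 𝔸)‖ ≤ 1) {τ τ' : ℝ}
    (hτ : ∀ (κ : ι) (z : S), ‖(((P z)⁻¹ * U κ z * P (T κ z) : 𝔸ˣ) : 𝔸) - 1‖ ≤ τ)
    (hτ' : ∀ (κ : ι) (z : S), ‖(((P' z)⁻¹ * U κ z * P' (T κ z) : 𝔸ˣ) : 𝔸) - 1‖ ≤ τ')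
    (steps : List (Equiv.Perm S)) (hsteps : ∀ σ ∈ steps, ∃ κ : ι, σ = T κ ∨ σ = (T κ).symm) (x : S) :
    ‖(((P (steps.foldl (fun z σ => σ z) x))⁻¹ * P' (steps.foldl (fun z σ => σ z) x) : 𝔸ˣ) : 𝔸) - (((P x)⁻¹ * P' x : 𝔸ˣ) : 𝔸)‖
      ≤ steps.length * (τ + τ') := by
  induction steps generalizing x with
  | nil => simp
  | cons σ rest ih =>
    have hσ := hsteps σ (by simp)
    have hrest : ∀ σ' ∈ rest, ∃ κ : ι, σ' = T κ ∨ σ' = (T κ).symm := fun σ' h => hsteps σ' (by simp [h])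
    -- one step from `x` to `σ x`
    have hone : ‖(((P (σ x))⁻¹ * P' (σ x) : 𝔸ˣ) : 𝔸) - (((P x)⁻¹ * P' x : 𝔸ˣ) : 𝔸)‖ ≤ τ + τ' := by
      obtain ⟨κ, hκ | hκ⟩ := hσ
      · subst hκ
        exact (norm_transition_step_sub_le T U hP hP' hU κ x).trans (add_le_add (hτ κ x) (hτ' κ x))
      · subst hκ
        have h := norm_transition_step_sub_le T U hP hP' hU κ ((T κ).symm x)
        have t1 := hτ κ ((T κ).symm x)
        have t2 := hτ' κ ((T κ).symm x)
        rw [Equiv.apply_symm_apply] at h t1 t2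
        rw [norm_sub_rev]
        exact h.trans (add_le_add t1 t2)
    have hih := ih hrest (σ x)
    simp only [List.foldl_cons, List.length_cons, Nat.cast_succ]
    calc _ ≤ ‖(((P (rest.foldl (fun z σ => σ z) (σ x)))⁻¹ * P' (rest.foldl (fun z σ => σ z) (σ x)) : 𝔸ˣ) : 𝔸)
              - (((P (σ x))⁻¹ * P' (σ x) : 𝔸ˣ) : 𝔸)‖
            + ‖(((P (σ x))⁻¹ * P' (σ x) : 𝔸ˣ) : 𝔸) - (((P x)⁻¹ * P' x : 𝔸ˣ) : 𝔸)‖ := norm_sub_le_norm_sub_add_norm_sub _ _ _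
      _ ≤ rest.length * (τ + τ') + (τ + τ') := add_le_add hih hone
      _ = (rest.length + 1) * (τ + τ') := by ring

omit T U in
/-- ★ **THE FRAME-MISMATCH ROW**: comparing the datum `m′` transported by the frame `P′` with its transport by `P` corrected at a reference site `x₀`:
`‖R(P x)(R(g x) m′) − R(P x)(R(g x₀) m′)‖ ≤ 2‖g(x) − g(x₀)‖·‖m′ − c‖` (`g = (P ·)⁻¹P′`, bi-contractive; `c` central). With `R_frame_transition` the first term IS `R(P′ x)m′`.
[cite: Balaban1985BackgroundPropagators, (3.3) p.390] -/
theorem norm_frame_mismatch_le {P P' : S → 𝔸ˣ} (hP : ∀ z : S, ‖(P z : 𝔸)‖ ≤ 1 ∧ ‖(((P z)⁻¹ : 𝔸ˣ) : 𝔸)‖ ≤ 1)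
    (hP' : ∀ z : S, ‖(P' z : 𝔸)‖ ≤ 1 ∧ ‖(((P' z)⁻¹ : 𝔸ˣ) : 𝔸)‖ ≤ 1) (m' c : 𝔸) (hc : ∀ a : 𝔸, Commute c a) (x x₀ : S) :
    ‖R (P x) (R ((P x)⁻¹ * P' x) m') - R (P x) (R ((P x₀)⁻¹ * P' x₀) m')‖
      ≤ 2 * ‖(((P x)⁻¹ * P' x : 𝔸ˣ) : 𝔸) - (((P x₀)⁻¹ * P' x₀ : 𝔸ˣ) : 𝔸)‖ * ‖m' - c‖ := by
  set g₁ : 𝔸ˣ := (P x)⁻¹ * P' x with hg₁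
  set g₀ : 𝔸ˣ := (P x₀)⁻¹ * P' x₀ with hg₀
  have b₁ := bicontr_mul (bicontr_inv (hP x)) (hP' x)
  have b₀ := bicontr_mul (bicontr_inv (hP x₀)) (hP' x₀)
  -- reduce to the traceless part: `R g c = c`
  have hred : R g₁ m' - R g₀ m' = R g₁ (m' - c) - R g₀ (m' - c) := by
    rw [R_sub, R_sub, R_eq_self_of_central g₁ c hc, R_eq_self_of_central g₀ c hc]; abel
  -- `‖R(u)w − R(u′)w‖ ≤ 2‖u − u′‖‖w‖` for bi-contractive `u, u′`
  have hRR : ∀ w : 𝔸, ‖R g₁ w - R g₀ w‖ ≤ 2 * ‖(g₁ : 𝔸) - g₀‖ * ‖w‖ := by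
    intro w
    have e : R g₁ w - R g₀ w = ((g₁ : 𝔸) - g₀) * w * ((g₁⁻¹ : 𝔸ˣ) : 𝔸)
        + (g₀ : 𝔸) * w * (((g₁⁻¹ : 𝔸ˣ) : 𝔸) * ((g₀ : 𝔸) - g₁) * ((g₀⁻¹ : 𝔸ˣ) : 𝔸)) := by
      have h1 : ((g₁⁻¹ : 𝔸ˣ) : 𝔸) * ((g₀ : 𝔸) - g₁) * ((g₀⁻¹ : 𝔸ˣ) : 𝔸) = ((g₁⁻¹ : 𝔸ˣ) : 𝔸) - ((g₀⁻¹ : 𝔸ˣ) : 𝔸) := by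
        rw [mul_sub, sub_mul, mul_assoc, Units.mul_inv, mul_one, Units.inv_mul, one_mul]
      rw [h1, R_def, R_def]
      noncomm_ring
    rw [e]
    have n1 : ‖((g₁ : 𝔸) - g₀) * w * ((g₁⁻¹ : 𝔸ˣ) : 𝔸)‖ ≤ ‖(g₁ : 𝔸) - g₀‖ * ‖w‖ := by
      calc _ ≤ ‖((g₁ : 𝔸) - g₀) * w‖ * ‖((g₁⁻¹ : 𝔸ˣ) : 𝔸)‖ := norm_mul_le _ _
        _ ≤ (‖(g₁ : 𝔸) - g₀‖ * ‖w‖) * 1 := by gcongr; exacts [norm_mul_le _ _, b₁.2]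
        _ = _ := mul_one _
    have n2 : ‖(g₀ : 𝔸) * w * (((g₁⁻¹ : 𝔸ˣ) : 𝔸) * ((g₀ : 𝔸) - g₁) * ((g₀⁻¹ : 𝔸ˣ) : 𝔸))‖ ≤ ‖(g₁ : 𝔸) - g₀‖ * ‖w‖ := by
      have n3 : ‖((g₁⁻¹ : 𝔸ˣ) : 𝔸) * ((g₀ : 𝔸) - g₁) * ((g₀⁻¹ : 𝔸ˣ) : 𝔸)‖ ≤ ‖(g₁ : 𝔸) - g₀‖ := by
        calc _ ≤ ‖((g₁⁻¹ : 𝔸ˣ) : 𝔸) * ((g₀ : 𝔸) - g₁)‖ * ‖((g₀⁻¹ : 𝔸ˣ) : 𝔸)‖ := norm_mul_le _ _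
          _ ≤ (‖((g₁⁻¹ : 𝔸ˣ) : 𝔸)‖ * ‖(g₀ : 𝔸) - g₁‖) * 1 := by gcongr; exacts [norm_mul_le _ _, b₀.2]
          _ ≤ (1 * ‖(g₀ : 𝔸) - g₁‖) * 1 := by gcongr; exact b₁.2
          _ = ‖(g₁ : 𝔸) - g₀‖ := by rw [one_mul, mul_one, norm_sub_rev]
      calc _ ≤ ‖(g₀ : 𝔸) * w‖ * ‖((g₁⁻¹ : 𝔸ˣ) : 𝔸) * ((g₀ : 𝔸) - g₁) * ((g₀⁻¹ : 𝔸ˣ) : 𝔸)‖ := norm_mul_le _ _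
        _ ≤ (‖(g₀ : 𝔸)‖ * ‖w‖) * ‖(g₁ : 𝔸) - g₀‖ := by gcongr; exact norm_mul_le _ _
        _ ≤ (1 * ‖w‖) * ‖(g₁ : 𝔸) - g₀‖ := by gcongr; exact b₀.1
        _ = ‖(g₁ : 𝔸) - g₀‖ * ‖w‖ := by ring
    exact (norm_add_le _ _).trans (by linarith)
  calc ‖R (P x) (R g₁ m') - R (P x) (R g₀ m')‖ = ‖R (P x) (R g₁ m' - R g₀ m')‖ := by rw [← R_sub]
    _ ≤ ‖R g₁ m' - R g₀ m'‖ := norm_R_le (hP x).1 (hP x).2 _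
    _ = ‖R g₁ (m' - c) - R g₀ (m' - c)‖ := by rw [hred]
    _ ≤ 2 * ‖(g₁ : 𝔸) - g₀‖ * ‖m' - c‖ := hRR _

end TwoFramesNorm

/-! ## §3 (APPEND v1.1) Frame versus holonomy along a lattice chain — the PAIR ROW's kernel (★routeR-w1 g5's F-H6 `D_y`)

Along a chain `x₀, x₁, …, x_n` of lattice steps (step `i` forward `x_{i+1} = x_i + e_{μ_i}` with bond unit `U_{μ_i}(x_i)`, or backward `x_{i+1} = x_i − e_{μ_i}` with bond unit
`U_{μ_i}(x_{i+1})⁻¹`), the holonomy `H_n = Π_i(bond units)` and ANY frame `P` satisfy the EXACT telescoping `(P x₀)⁻¹·H_n·P(x_n) = Π_i h_i`, `h_i` = the frame holonomy of step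
`i` (inverted for backward steps).  Hence `‖H_n − P(x₀)·P(x_n)⁻¹‖ ≤ Σ_i‖h_i − 1‖ ≤ n·τ` under LOCAL size rows at the chain's bonds only: in a (3.35) cube gauge `P = u⁻¹` the straight
transport between two centres IS `u(c₀)⁻¹u(c)` up to `n·τ₁ = O(ℓ·eℓ⁻¹) = O(e)`.  The chain and its holonomy enter as FUNCTIONS `x : ℕ → S`, `H : ℕ → 𝔸ˣ` with their recursions
DISPLAYED (no path letter of any carrier; the consumer instantiates with `holT`∕`walk`). -/

section Chain

variable {𝔸 : Type} [NormedRing 𝔸] {S : Type*} {ι : Type*} (T : ι → Equiv.Perm S) (U : ι → S → 𝔸ˣ)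

omit T U in
/-- Products of near-identity units stay near the identity: `‖K·h − 1‖ ≤ ‖K − 1‖ + ‖h − 1‖` when `‖h‖ ≤ 1` (`Kh − 1 = (K − 1)h + (h − 1)`). [folklore] -/
theorem norm_mul_sub_one_le (K : 𝔸ˣ) {h : 𝔸ˣ} (hh : ‖(h : 𝔸)‖ ≤ 1) :
    ‖((K * h : 𝔸ˣ) : 𝔸) - 1‖ ≤ ‖(K : 𝔸) - 1‖ + ‖(h : 𝔸) - 1‖ := by
  have e : ((K * h : 𝔸ˣ) : 𝔸) - 1 = ((K : 𝔸) - 1) * (h : 𝔸) + ((h : 𝔸) - 1) := by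
    rw [Units.val_mul, sub_mul, one_mul]; abel
  rw [e]
  calc _ ≤ ‖((K : 𝔸) - 1) * (h : 𝔸)‖ + ‖(h : 𝔸) - 1‖ := norm_add_le _ _
    _ ≤ ‖(K : 𝔸) - 1‖ * ‖(h : 𝔸)‖ + ‖(h : 𝔸) - 1‖ := by gcongr; exact norm_mul_le _ _
    _ ≤ ‖(K : 𝔸) - 1‖ * 1 + ‖(h : 𝔸) - 1‖ := by gcongr
    _ = _ := by rw [mul_one]

/-- ★★ **FRAME VERSUS HOLONOMY ALONG A CHAIN, EXACT + NORM**.  Data: sites `x : ℕ → S`, directions `μ : ℕ → ι`, orientations `fwd : ℕ → Bool`, holonomy `H : ℕ → 𝔸ˣ` with the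
DISPLAYED recursions `hx` (the chain follows the shifts) and `hH0`∕`hHs` (`H 0 = 1`, `H (i+1) = H i · (bond unit of step i)`); frame `P` bi-contractive, background bi-contractive;
LOCAL size rows `hloc` on the frame holonomies of the chain's bonds only.  Conclusion: `‖H n − P(x 0)·P(x n)⁻¹‖ ≤ n·τ`. [cite: Balaban1985BackgroundPropagators, (3.35) p.396, (3.40) p.397] -/
theorem norm_hol_sub_frame_pair_le {P : S → 𝔸ˣ} (hP : ∀ z : S, ‖(P z : 𝔸)‖ ≤ 1 ∧ ‖(((P z)⁻¹ : 𝔸ˣ) : 𝔸)‖ ≤ 1)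
    (hU : ∀ (κ : ι) (z : S), ‖(U κ z : 𝔸)‖ ≤ 1 ∧ ‖(((U κ z)⁻¹ : 𝔸ˣ) : 𝔸)‖ ≤ 1)
    (x : ℕ → S) (μ : ℕ → ι) (fwd : ℕ → Bool) (H : ℕ → 𝔸ˣ)
    (hx : ∀ i, x (i + 1) = if fwd i then T (μ i) (x i) else (T (μ i)).symm (x i))
    (hH0 : H 0 = 1) (hHs : ∀ i, H (i + 1) = H i * (if fwd i then U (μ i) (x i) else (U (μ i) (x (i + 1)))⁻¹))
    {τ : ℝ} (hloc : ∀ i, ‖((((P (if fwd i then x i else x (i + 1)))⁻¹ * U (μ i) (if fwd i then x i else x (i + 1))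
        * P (T (μ i) (if fwd i then x i else x (i + 1))) : 𝔸ˣ) : 𝔸)) - 1‖ ≤ τ)
    (n : ℕ) :
    ‖((H n : 𝔸ˣ) : 𝔸) - ((P (x 0) * (P (x n))⁻¹ : 𝔸ˣ) : 𝔸)‖ ≤ n * τ := by
  -- the conjugated holonomy `K i := (P x₀)⁻¹ · H i · P(x i)` telescopes into the product of the frame holonomies
  have hK : ∀ i, ‖((((P (x 0))⁻¹ * H i * P (x i) : 𝔸ˣ) : 𝔸)) - 1‖ ≤ i * τ := by
    intro i
    induction i with
    | zero => simp [hH0]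
    | succ i ih =>
      by_cases hf : fwd i = true
      · -- forward step: `x (i+1) = T μ (x i)`, bond unit `U μ (x i)`
        have hxi : x (i + 1) = T (μ i) (x i) := by simpa [hf] using hx i
        have hrec : ((P (x 0))⁻¹ * H (i + 1) * P (x (i + 1)) : 𝔸ˣ)
            = ((P (x 0))⁻¹ * H i * P (x i)) * ((P (x i))⁻¹ * U (μ i) (x i) * P (T (μ i) (x i))) := by
          rw [hHs i, hxi]; simp [hf]; group
        have hli : ‖((((P (x i))⁻¹ * U (μ i) (x i) * P (T (μ i) (x i)) : 𝔸ˣ) : 𝔸)) - 1‖ ≤ τ := by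
          simpa [hf] using hloc i
        have bh := bicontr_mul (bicontr_mul (bicontr_inv (hP (x i))) (hU (μ i) (x i))) (hP (T (μ i) (x i)))
        rw [hrec]
        calc _ ≤ _ := norm_mul_sub_one_le _ bh.1
          _ ≤ i * τ + τ := add_le_add ih hli
          _ = (i + 1 : ℕ) * τ := by push_cast; ring
      · -- backward step: `x (i+1) = (T μ).symm (x i)`, bond unit `(U μ (x (i+1)))⁻¹`, frame holonomy inverted
        have hf' : fwd i = false := by simpa using hf
        have hxi : x (i + 1) = (T (μ i)).symm (x i) := by simpa [hf'] using hx i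
        have hTx : T (μ i) (x (i + 1)) = x i := by rw [hxi, Equiv.apply_symm_apply]
        have hrec : ((P (x 0))⁻¹ * H (i + 1) * P (x (i + 1)) : 𝔸ˣ)
            = ((P (x 0))⁻¹ * H i * P (x i)) * ((P (x (i + 1)))⁻¹ * U (μ i) (x (i + 1)) * P (T (μ i) (x (i + 1))))⁻¹ := by
          rw [hHs i, hTx]; simp [hf']; group
        have hli : ‖((((P (x (i + 1)))⁻¹ * U (μ i) (x (i + 1)) * P (T (μ i) (x (i + 1))) : 𝔸ˣ) : 𝔸)) - 1‖ ≤ τ := by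
          simpa [hf'] using hloc i
        have bh := bicontr_mul (bicontr_mul (bicontr_inv (hP (x (i + 1)))) (hU (μ i) (x (i + 1)))) (hP (T (μ i) (x (i + 1))))
        -- `‖h⁻¹ − 1‖ ≤ ‖h − 1‖`
        have hinv : ‖(((((P (x (i + 1)))⁻¹ * U (μ i) (x (i + 1)) * P (T (μ i) (x (i + 1))))⁻¹ : 𝔸ˣ) : 𝔸)) - 1‖ ≤ τ := by
          set h : 𝔸ˣ := (P (x (i + 1)))⁻¹ * U (μ i) (x (i + 1)) * P (T (μ i) (x (i + 1))) with hh
          have e : ((h⁻¹ : 𝔸ˣ) : 𝔸) - 1 = ((h⁻¹ : 𝔸ˣ) : 𝔸) * (1 - (h : 𝔸)) := by rw [mul_sub, mul_one, Units.inv_mul]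
          rw [e]
          calc _ ≤ ‖((h⁻¹ : 𝔸ˣ) : 𝔸)‖ * ‖1 - (h : 𝔸)‖ := norm_mul_le _ _
            _ ≤ 1 * ‖1 - (h : 𝔸)‖ := by gcongr; exact bh.2
            _ = ‖(h : 𝔸) - 1‖ := by rw [one_mul, norm_sub_rev]
            _ ≤ τ := hli
        rw [hrec]
        calc _ ≤ _ := norm_mul_sub_one_le _ bh.2
          _ ≤ i * τ + τ := add_le_add ih hinv
          _ = (i + 1 : ℕ) * τ := by push_cast; ring
  -- undo the conjugation: `H n − P(x₀)P(x n)⁻¹ = P(x₀)·(K n − 1)·P(x n)⁻¹`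
  have e1 : (P (x 0) : 𝔸) * ((((P (x 0))⁻¹ * H n * P (x n) : 𝔸ˣ) : 𝔸)) * (((P (x n))⁻¹ : 𝔸ˣ) : 𝔸) = (H n : 𝔸) := by
    rw [← Units.val_mul, ← Units.val_mul]
    congr 1
    group
  have e : ((H n : 𝔸ˣ) : 𝔸) - ((P (x 0) * (P (x n))⁻¹ : 𝔸ˣ) : 𝔸)
      = (P (x 0) : 𝔸) * (((((P (x 0))⁻¹ * H n * P (x n) : 𝔸ˣ) : 𝔸)) - 1) * (((P (x n))⁻¹ : 𝔸ˣ) : 𝔸) := by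
    rw [mul_sub, sub_mul, mul_one, e1, Units.val_mul]
  rw [e]
  calc _ ≤ ‖(P (x 0) : 𝔸) * (((((P (x 0))⁻¹ * H n * P (x n) : 𝔸ˣ) : 𝔸)) - 1)‖ * ‖(((P (x n))⁻¹ : 𝔸ˣ) : 𝔸)‖ := norm_mul_le _ _
    _ ≤ (‖(P (x 0) : 𝔸)‖ * ‖((((P (x 0))⁻¹ * H n * P (x n) : 𝔸ˣ) : 𝔸)) - 1‖) * 1 := by gcongr; exacts [norm_mul_le _ _, (hP (x n)).2]
    _ ≤ (1 * (n * τ)) * 1 := by gcongr; exacts [(hP (x 0)).1, hK n]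
    _ = n * τ := by ring

end Chain

end Summit.QuantumFields.YangMills.Theorems.Prop7ConjFrameTransition

end
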